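import Mathlib.Algebra.Group.Pointwise.Finset.Basic
import Mathlib.Algebra.Order.BigOperators.Group.Finset
import Mathlib.Tactic.Group
import Mathlib.Tactic.Ring
import Literature.Combinatorics.Additive.TripleProductProperty
import Literature.Combinatorics.Additive.TPPGroupAlgebra
import HarnessLib

/-!
# No member of a non-trivial TPP triple permutes with another member and its inverse (Murthy 2026, Prop. 2.6 (1), SUBSETS)

Topic `Literature/Combinatorics/Additive` (the tree's right-quotient `TripleProductProperty` of
`TripleProductProperty.lean`: `s s'⁻¹ · t t'⁻¹ · u u'⁻¹ = 1 ⇒ s = s', t = t', u = u'`; companion of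
`MurthyTPPInsideSubgroup.lean` (Prop. 2.7 / Cor. 2.8 / Prop. 2.6 (3)) and of
`Literature/Computability/AlgebraicComplexity/SubgroupTPPPermutability.lean` (the SUBGROUP form of
Prop. 2.6 (1))).

S. R. Murthy, *On the triple product property for subgroups of finite nilpotent groups of class 2*,
arXiv:2602.15796v1 (2026), p. 5, verbatim:

> **Definition 2.5.** Two non-empty subsets `X, Y` of a group `G` are said to *permute* (in `G`), or,
> equivalently, be *permutable* (in `G`), if `XY = YX`, where `XY = {xy | x ∈ X, y ∈ Y}` and
> `YX = {yx | x ∈ X, y ∈ Y}`.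
>
> **Proposition 2.6.** Let `(S, T, U)` be a non-trivial TPP triple of a group `G`, that is, one such
> that `|S||T||U| > |G|`. Then
> (1) No member `S, T, U` permutes with another member and its inverse, that is, for any distinct
> `X, Y ∈ {S, T, U}` either `XY ≠ YX` or `XY⁻¹ ≠ Y⁻¹X`. […]
> *Proof.* (1) Let `S` permute with `T` and `T⁻¹`. Then `Q(ST) = ST(ST)⁻¹ = STT⁻¹S⁻¹ = TT⁻¹SS⁻¹ =
> Q(T)Q(S)`, where `Q(T)Q(S) ∩ Q(U) = {1}` (by the TPP for the permuted triple `(T, S, U)`), and so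
> by [4, Lemma 3.1] `(ST, U, {1})` is a TPP triple of `G` such that `|S||T||U| ≤ |G|`, a
> contradiction. Thus `S` does not permute with `T` and `T⁻¹`, and, analogously, `S` does not permute
> with `U` and `U⁻¹`, and `T` does not permute with `U` and `U⁻¹`.

([4] = Cohn–Umans 2003; "[4, Lemma 3.1]" is used in the note for "an improper TPP triple is always
trivial", p. 4.)

## What is here (all proved; 0 definitions, 0 named facts)

* `card_mul_eq_of_quot_disjoint_of_comm` — **the counting step the printed proof leaves implicit**:
  if `Q(S) ∩ Q(T) = {1}` (in the form `s s'⁻¹ · t t'⁻¹ = 1 ⇒ s = s', t = t'`, which is the TPP with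
  `u = u'`) and `ST = TS`, then `|ST| = |S| |T|`.  (The printed proof concludes `|S||T||U| ≤ |G|` from
  the TPP of `(ST, U, {1})`, which gives `|ST| |U| ≤ |G|`; for SUBGROUPS `|ST| = |S||T|` is immediate
  from `S ∩ T = 1`, for subsets it is this lemma.)  Proof (double counting): the coincidences
  `C = {((s,t),(t',s')) : st = t's'}` inject into `S × T` by `((s,t),(t',s')) ↦ (s', t)` — the
  element `t'⁻¹ s = s' t⁻¹` and then `(t', s)` are determined, `(t', s) ↦ t'⁻¹ s` being injective by
  `Q(T) ∩ Q(S) = {1}` — while every fibre of `C → S × T` is non-empty because `ST ⊆ TS`; so all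
  fibres are singletons, i.e. `(t, s) ↦ ts` is injective on `T × S`, and `|ST| = |TS| = |T||S|`.
* `TripleProductProperty.mul_quot_tpp` — the TPP of `(ST, U, {1})` in the note's sense: for
  `a, a' ∈ ST` and `u, u' ∈ U`, `a a'⁻¹ u u'⁻¹ = 1 ⇒ a = a' ∧ u = u'` (uses both `ST = TS` and
  `ST⁻¹ = T⁻¹S` to rewrite `a a'⁻¹` as an `S`-quotient times a `T`-quotient, so that the TPP of
  `(S, T, U)` itself applies — the note invokes the permuted triple `(T, S, U)` instead).
* `Murthy2026_prop26_1` — **Prop. 2.6 (1) as printed (contrapositive, for the pair `(S, T)`)**: a TPP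
  triple of finite subsets of a finite group with `ST = TS` and `ST⁻¹ = T⁻¹S` has
  `|S| |T| |U| ≤ |G|`; `Murthy2026_prop26_1_ne` — the printed form: if `|S||T||U| > |G|` then
  `ST ≠ TS ∨ ST⁻¹ ≠ T⁻¹S`; `Murthy2026_prop26_1_all` — all three (unordered) pairs `{S,T}`, `{T,U}`,
  `{U,S}` via `TripleProductProperty.rotate` (for an ordered pair `(Y, X)` the printed condition
  `YX = XY ∧ YX⁻¹ = X⁻¹Y` is equivalent to the one for `(X, Y)` by taking inverses, so the three
  unordered pairs are the whole printed statement).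
* `mul_comm_of_forall_mem_normalizer`, `Murthy2026_prop26_2_subset_normalizer` — the "or by each other"
  clause of **Prop. 2.6 (2)** for SUBSETS ("`Y ⊄ N_G(X)`"): if every element of the member `T`
  normalises the set `S`, then `S` permutes with `T` and `T⁻¹` (the note's one-line reduction) and the
  triple is trivial.  (The clause "`N_G(X) < G`" is `Murthy2026_prop26_2_subset` in
  `Literature/Computability/AlgebraicComplexity/TPPNormalMember.lean`; the subgroup forms are in
  `SubgroupTPPQuotient.lean` / `SubgroupTPPPermutability.lean`.)

Census reading (pub-omega, family (b), SUBSET triples): a search may discard every candidate pair of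
members `(X, Y)` with `XY = YX` and `XY⁻¹ = Y⁻¹X` — in particular any pair in which every element of
one member normalises the other member as a set — before any third member is tried.

## References
* S. R. Murthy, arXiv:2602.15796v1 (2026): Def. 2.5, Prop. 2.6 (1) with proof, p. 5; "an improper
  TPP triple is always trivial [4, Proof of Lemma 3.1]", p. 4. [Murthy2026]
* H. Cohn, C. Umans, *A group-theoretic approach to fast matrix multiplication*, FOCS 2003, Def. 2.1
  and Lemma 3.1. [CohnUmans2003]
-/

namespace Literature.Combinatorics.Additive

open Finset
open scoped Pointwise

variable {G : Type*} [Group G] [DecidableEq G]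

/-- **`(t, s) ↦ ts` is injective for permutable sets with disjoint quotient sets.** If
`s s'⁻¹ · t t'⁻¹ = 1` forces `s = s'`, `t = t'` (i.e. `Q(S) ∩ Q(T) = {1}`) and `ST = TS`, then two
factorisations `t₁ s₁ = t₂ s₂` with `tᵢ ∈ T`, `sᵢ ∈ S` coincide.  Double counting, see the module
docstring. [cite: Murthy2026, Prop. 2.6 (1) (proof)] -/
theorem mul_injOn_of_quot_disjoint_of_comm {S T : Finset G}
    (hQ : ∀ s ∈ S, ∀ s' ∈ S, ∀ t ∈ T, ∀ t' ∈ T, s * s'⁻¹ * (t * t'⁻¹) = 1 → s = s' ∧ t = t')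
    (hperm : S * T = T * S) {t₁ s₁ t₂ s₂ : G} (ht₁ : t₁ ∈ T) (hs₁ : s₁ ∈ S) (ht₂ : t₂ ∈ T)
    (hs₂ : s₂ ∈ S) (heq : t₁ * s₁ = t₂ * s₂) : t₁ = t₂ ∧ s₁ = s₂ := by
  classical
  by_contra hne
  -- the coincidence set `C = {((s,t),(t',s')) : s t = t' s'}`
  let P : (G × G) × (G × G) → Prop := fun q => q.1.1 * q.1.2 = q.2.1 * q.2.2
  let C := ((S ×ˢ T) ×ˢ (T ×ˢ S)).filter P
  have memC : ∀ {s t t' s' : G}, s ∈ S → t ∈ T → t' ∈ T → s' ∈ S → s * t = t' * s' →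
      ((s, t), (t', s')) ∈ C := fun hs ht ht' hs' e =>
    Finset.mem_filter.2 ⟨Finset.mem_product.2 ⟨Finset.mem_product.2 ⟨hs, ht⟩,
      Finset.mem_product.2 ⟨ht', hs'⟩⟩, e⟩
  have ofC : ∀ {q : (G × G) × (G × G)}, q ∈ C →
      (q.1.1 ∈ S ∧ q.1.2 ∈ T) ∧ (q.2.1 ∈ T ∧ q.2.2 ∈ S) ∧ q.1.1 * q.1.2 = q.2.1 * q.2.2 := fun hq => by
    have h1 := Finset.mem_filter.1 hq
    have h2 := Finset.mem_product.1 h1.1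
    exact ⟨Finset.mem_product.1 h2.1, Finset.mem_product.1 h2.2, h1.2⟩
  -- (1) `C` injects into `S × T` by `((s,t),(t',s')) ↦ (s', t)`
  have hle : C.card ≤ (S ×ˢ T).card := by
    refine Finset.card_le_card_of_injOn (fun q => (q.2.2, q.1.2)) (fun q hq => ?_) ?_
    · obtain ⟨⟨-, ht⟩, ⟨-, hs'⟩, -⟩ := ofC hq
      exact Finset.mem_product.2 ⟨hs', ht⟩
    · rintro ⟨⟨s, t⟩, ⟨t', s'⟩⟩ hq ⟨⟨σ, τ⟩, ⟨τ', σ'⟩⟩ hq' he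
      obtain ⟨⟨hs, -⟩, ⟨ht', -⟩, e⟩ := ofC (Finset.mem_coe.1 hq)
      obtain ⟨⟨hσ, -⟩, ⟨hτ', -⟩, e'⟩ := ofC (Finset.mem_coe.1 hq')
      simp only [Prod.mk.injEq] at he e e'
      obtain ⟨rfl, rfl⟩ := he
      -- now `s' = σ'`, `t = τ`; from `s t = t' s'` and `σ t = τ' s'`: `σ s⁻¹ · (t' τ'⁻¹) = 1`
      have hw : σ * s⁻¹ * (t' * τ'⁻¹) = 1 := by
        have e1 : t' = s * t * s'⁻¹ := by rw [e]; group
        have e2 : τ' = σ * t * s'⁻¹ := by rw [e']; group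
        rw [e1, e2]; group
      obtain ⟨h1, h2⟩ := hQ σ hσ s hs t' ht' τ' hτ' hw
      subst h1; subst h2
      rfl
  -- `m = t₁ s₁ ∈ TS = ST`, say `m = s t`
  have hm : t₁ * s₁ ∈ S * T := by rw [hperm]; exact Finset.mul_mem_mul ht₁ hs₁
  obtain ⟨s, hs, t, ht, hst⟩ := Finset.mem_mul.1 hm
  -- (2) fibre cardinalities of `C → S × T`: all `≥ 1` (`ST ⊆ TS`), the one over `(s, t)` is `≥ 2`
  let g : G × G → ℕ := fun p => (C.filter (fun q => q.1 = p)).card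
  have hsum : C.card = ∑ p ∈ S ×ˢ T, g p :=
    Finset.card_eq_sum_card_fiberwise fun q hq => by
      obtain ⟨⟨hs₀, ht₀⟩, -, -⟩ := ofC hq
      exact Finset.mem_product.2 ⟨hs₀, ht₀⟩
  have hg1 : ∀ p ∈ S ×ˢ T, 1 ≤ g p := by
    rintro ⟨σ, τ⟩ hp
    obtain ⟨hσ, hτ⟩ := Finset.mem_product.1 hp
    have hm' : σ * τ ∈ T * S := by rw [← hperm]; exact Finset.mul_mem_mul hσ hτ
    obtain ⟨τ', hτ', σ', hσ', e⟩ := Finset.mem_mul.1 hm'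
    exact Finset.card_pos.2 ⟨((σ, τ), (τ', σ')),
      Finset.mem_filter.2 ⟨memC hσ hτ hτ' hσ' e.symm, rfl⟩⟩
  have hst_mem : (s, t) ∈ S ×ˢ T := Finset.mem_product.2 ⟨hs, ht⟩
  have hg2 : 2 ≤ g (s, t) := by
    refine Finset.one_lt_card.2 ⟨((s, t), (t₁, s₁)), ?_, ((s, t), (t₂, s₂)), ?_, ?_⟩
    · exact Finset.mem_filter.2 ⟨memC hs ht ht₁ hs₁ hst, rfl⟩
    · exact Finset.mem_filter.2 ⟨memC hs ht ht₂ hs₂ (hst.trans heq), rfl⟩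
    · intro h
      apply hne
      simp only [Prod.mk.injEq] at h
      exact ⟨h.2.1, h.2.2⟩
  -- (3) `C.card ≥ |S × T| + 1`, contradicting (1)
  have hbig : (S ×ˢ T).card + 1 ≤ C.card := by
    rw [hsum, ← Finset.add_sum_erase _ _ hst_mem]
    have hrest : ∑ _p ∈ (S ×ˢ T).erase (s, t), 1 ≤ ∑ p ∈ (S ×ˢ T).erase (s, t), g p :=
      Finset.sum_le_sum fun p hp => hg1 p (Finset.mem_of_mem_erase hp)
    rw [← Finset.card_eq_sum_ones, Finset.card_erase_of_mem hst_mem] at hrest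
    have hpos : 1 ≤ (S ×ˢ T).card := Finset.card_pos.2 ⟨_, hst_mem⟩
    omega
  omega

/-- **`|ST| = |S||T|` for permutable sets with disjoint quotient sets** — the step left implicit in
the printed proof of Prop. 2.6 (1): under `Q(S) ∩ Q(T) = {1}` and `ST = TS`, `|ST| = |TS| = |T| |S|`.
[cite: Murthy2026, Prop. 2.6 (1) (proof)] -/
theorem card_mul_eq_of_quot_disjoint_of_comm {S T : Finset G}
    (hQ : ∀ s ∈ S, ∀ s' ∈ S, ∀ t ∈ T, ∀ t' ∈ T, s * s'⁻¹ * (t * t'⁻¹) = 1 → s = s' ∧ t = t')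
    (hperm : S * T = T * S) : (S * T).card = S.card * T.card := by
  have hinj : Set.InjOn (fun p : G × G => p.1 * p.2) ((T : Set G) ×ˢ (S : Set G)) := by
    rintro ⟨t₁, s₁⟩ h₁ ⟨t₂, s₂⟩ h₂ heq
    obtain ⟨ht₁, hs₁⟩ := Set.mem_prod.1 h₁
    obtain ⟨ht₂, hs₂⟩ := Set.mem_prod.1 h₂
    obtain ⟨e1, e2⟩ := mul_injOn_of_quot_disjoint_of_comm hQ hperm (Finset.mem_coe.1 ht₁)
      (Finset.mem_coe.1 hs₁) (Finset.mem_coe.1 ht₂) (Finset.mem_coe.1 hs₂) heq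
    exact Prod.ext e1 e2
  rw [hperm, Finset.card_mul_iff.2 hinj, mul_comm]

/-- **The TPP of `(ST, U, {1})`** (the note's "`Q(ST) = Q(T)Q(S)`, where `Q(T)Q(S) ∩ Q(U) = {1}`"): for a
TPP triple `(S, T, U)` with `ST = TS` and `ST⁻¹ = T⁻¹S`, any `a, a' ∈ ST`, `u, u' ∈ U` with
`a a'⁻¹ u u'⁻¹ = 1` have `a = a'` and `u = u'`.  (Writing `a = s₁t₁`, `a' = s₂t₂`: `s₂t₂ = τσ ∈ TS`,
`σ t₁⁻¹ = τ₃'σ₃ ∈ T⁻¹S`, so `a a'⁻¹ = (s₁ σ₃⁻¹)(τ₃'⁻¹ τ⁻¹)` and the TPP of `(S, T, U)` applies.)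
[cite: Murthy2026, Prop. 2.6 (1) (proof)] -/
theorem TripleProductProperty.mul_quot_tpp {S T U : Finset G} (h : TripleProductProperty S T U)
    (hperm : S * T = T * S) (hperm' : S * T⁻¹ = T⁻¹ * S)
    {a a' u u' : G} (ha : a ∈ S * T) (ha' : a' ∈ S * T) (hu : u ∈ U) (hu' : u' ∈ U)
    (hw : a * a'⁻¹ * (u * u'⁻¹) = 1) : a = a' ∧ u = u' := by
  obtain ⟨s₁, hs₁, t₁, ht₁, rfl⟩ := Finset.mem_mul.1 ha
  obtain ⟨s₂, hs₂, t₂, ht₂, rfl⟩ := Finset.mem_mul.1 ha'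
  -- `s₂ t₂ = τ σ` with `τ ∈ T`, `σ ∈ S`
  have h2 : s₂ * t₂ ∈ T * S := by rw [← hperm]; exact Finset.mul_mem_mul hs₂ ht₂
  obtain ⟨τ, hτ, σ, hσ, e2⟩ := Finset.mem_mul.1 h2
  -- `σ t₁⁻¹ = τ₃' σ₃` with `τ₃' ∈ T⁻¹`, `σ₃ ∈ S`
  have h3 : σ * t₁⁻¹ ∈ T⁻¹ * S := by
    rw [← hperm']; exact Finset.mul_mem_mul hσ (Finset.inv_mem_inv ht₁)
  obtain ⟨τ₃', hτ₃', σ₃, hσ₃, e3⟩ := Finset.mem_mul.1 h3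
  have hτ₃ : τ₃'⁻¹ ∈ T := Finset.mem_inv'.1 hτ₃'
  -- `a a'⁻¹ = s₁ t₁ (τσ)⁻¹ = s₁ (σ t₁⁻¹)⁻¹ τ⁻¹ = (s₁ σ₃⁻¹)(τ₃'⁻¹ τ⁻¹)`
  have e4 : s₁ * t₁ * (s₂ * t₂)⁻¹ = s₁ * σ₃⁻¹ * (τ₃'⁻¹ * τ⁻¹) := by
    rw [← e2]
    calc s₁ * t₁ * (τ * σ)⁻¹ = s₁ * (σ * t₁⁻¹)⁻¹ * τ⁻¹ := by group
      _ = s₁ * (τ₃' * σ₃)⁻¹ * τ⁻¹ := by rw [e3]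
      _ = s₁ * σ₃⁻¹ * (τ₃'⁻¹ * τ⁻¹) := by group
  have hword : s₁ * σ₃⁻¹ * (τ₃'⁻¹ * τ⁻¹) * (u * u'⁻¹) = 1 := by rw [← e4]; exact hw
  obtain ⟨-, -, e7⟩ := h s₁ hs₁ σ₃ hσ₃ τ₃'⁻¹ hτ₃ τ hτ u hu u' hu' hword
  subst e7
  refine ⟨?_, rfl⟩
  rw [mul_inv_cancel, mul_one] at hw
  exact mul_inv_eq_one.1 hw

/-- **Murthy 2026, Prop. 2.6 (1), as printed, for the pair `(S, T)` (contrapositive)**: if `(S, T, U)`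
is a TPP triple of finite subsets of a finite group and `S` permutes with `T` and with `T⁻¹`
(`ST = TS` and `ST⁻¹ = T⁻¹S`), then `|S| |T| |U| ≤ |G|` — the triple is trivial.  Proof as printed
("`(ST, U, {1})` is a TPP triple, so `|S||T||U| ≤ |G|"), with the two counting steps made explicit:
`(a, u) ↦ a⁻¹u` is injective on `ST × U` (`TripleProductProperty.mul_quot_tpp`), so
`|ST| |U| ≤ |G|`, and `|ST| = |S| |T|` (`card_mul_eq_of_quot_disjoint_of_comm`).
[cite: Murthy2026, Prop. 2.6 (1)] -/
theorem Murthy2026_prop26_1 [Fintype G] {S T U : Finset G} (h : TripleProductProperty S T U)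
    (hperm : S * T = T * S) (hperm' : S * T⁻¹ = T⁻¹ * S) :
    S.card * T.card * U.card ≤ Fintype.card G := by
  classical
  rcases U.eq_empty_or_nonempty with hU | hU
  · simp [hU]
  obtain ⟨u₀, hu₀⟩ := hU
  -- `Q(S) ∩ Q(T) = {1}` from the TPP with `u = u' = u₀`
  have hQ : ∀ s ∈ S, ∀ s' ∈ S, ∀ t ∈ T, ∀ t' ∈ T, s * s'⁻¹ * (t * t'⁻¹) = 1 → s = s' ∧ t = t' := by
    intro s hs s' hs' t ht t' ht' e
    have e' : s * s'⁻¹ * (t * t'⁻¹) * (u₀ * u₀⁻¹) = 1 := by rw [mul_inv_cancel, mul_one, e]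
    obtain ⟨h1, h2, -⟩ := h s hs s' hs' t ht t' ht' u₀ hu₀ u₀ hu₀ e'
    exact ⟨h1, h2⟩
  have hcard : (S * T).card = S.card * T.card := card_mul_eq_of_quot_disjoint_of_comm hQ hperm
  -- `(a, u) ↦ a⁻¹ u` is injective on `ST × U`
  have hinj : Set.InjOn (fun p : G × G => p.1⁻¹ * p.2) ↑((S * T) ×ˢ U) := by
    rintro ⟨a, u⟩ hp ⟨a', u'⟩ hp' he
    obtain ⟨ha, hu⟩ := Finset.mem_product.1 (Finset.mem_coe.1 hp)
    obtain ⟨ha', hu'⟩ := Finset.mem_product.1 (Finset.mem_coe.1 hp')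
    simp only at he
    -- `a⁻¹ u = a'⁻¹ u'` gives `a' a⁻¹ · u u'⁻¹ = 1`
    have hw : a' * a⁻¹ * (u * u'⁻¹) = 1 := by
      calc a' * a⁻¹ * (u * u'⁻¹) = a' * (a⁻¹ * u) * u'⁻¹ := by group
        _ = a' * (a'⁻¹ * u') * u'⁻¹ := by rw [he]
        _ = 1 := by group
    obtain ⟨e1, e2⟩ := h.mul_quot_tpp hperm hperm' ha' ha hu hu' hw
    exact Prod.ext e1.symm e2
  have hle := Finset.card_le_card_of_injOn (fun p : G × G => p.1⁻¹ * p.2)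
    (fun p _ => Finset.mem_univ _) hinj
  rw [Finset.card_product, hcard, Finset.card_univ] at hle
  exact hle

/-- **Murthy 2026, Prop. 2.6 (1), printed form**: in a non-trivial TPP triple of subsets of a finite group
(`|S||T||U| > |G|`) the member `S` does not permute with both `T` and `T⁻¹`: `ST ≠ TS` or
`ST⁻¹ ≠ T⁻¹S`.  (The pairs `(S, U)` and `(T, U)` follow by the permutation invariance of the TPP.)
[cite: Murthy2026, Prop. 2.6 (1)] -/
theorem Murthy2026_prop26_1_ne [Fintype G] {S T U : Finset G} (h : TripleProductProperty S T U)
    (hnt : Fintype.card G < S.card * T.card * U.card) :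
    S * T ≠ T * S ∨ S * T⁻¹ ≠ T⁻¹ * S := by
  by_contra hc
  obtain ⟨h1, h2⟩ := not_or.1 hc
  exact absurd (Murthy2026_prop26_1 h (not_ne_iff.1 h1) (not_ne_iff.1 h2)) (not_le.2 hnt)

/-- **Murthy 2026, Prop. 2.6 (1), all three pairs**: in a non-trivial TPP triple of subsets of a finite
group no member permutes with another member and its inverse — for `{S,T}`, `{T,U}`, `{U,S}` (the triple
rotated by `TripleProductProperty.rotate`). [cite: Murthy2026, Prop. 2.6 (1)] -/
theorem Murthy2026_prop26_1_all [Fintype G] {S T U : Finset G} (h : TripleProductProperty S T U)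
    (hnt : Fintype.card G < S.card * T.card * U.card) :
    (S * T ≠ T * S ∨ S * T⁻¹ ≠ T⁻¹ * S) ∧ (T * U ≠ U * T ∨ T * U⁻¹ ≠ U⁻¹ * T) ∧
      (U * S ≠ S * U ∨ U * S⁻¹ ≠ S⁻¹ * U) := by
  refine ⟨Murthy2026_prop26_1_ne h hnt, Murthy2026_prop26_1_ne h.rotate ?_,
    Murthy2026_prop26_1_ne h.rotate.rotate ?_⟩
  · calc Fintype.card G < S.card * T.card * U.card := hnt
      _ = T.card * U.card * S.card := by ring
  · calc Fintype.card G < S.card * T.card * U.card := hnt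
      _ = U.card * S.card * T.card := by ring

/-! ## Prop. 2.6 (2), "or by each other", for subsets: a member normalised by another member -/

/-- If every element of `T` normalises the SET `S` (`t S t⁻¹ = S`), then `S` permutes with `T` and with
`T⁻¹`. [cite: Murthy2026, Prop. 2.6 (2) (proof: "Then `S` permutes with `T` and `T⁻¹`")] -/
theorem mul_comm_of_forall_mem_normalizer {S T : Finset G}
    (hN : ∀ t ∈ T, ∀ x : G, x ∈ S ↔ t * x * t⁻¹ ∈ S) :
    S * T = T * S ∧ S * T⁻¹ = T⁻¹ * S := by
  -- `t⁻¹ s t ∈ S` and `t s t⁻¹ ∈ S` for `t ∈ T`, `s ∈ S`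
  have hconj : ∀ t ∈ T, ∀ s ∈ S, t * s * t⁻¹ ∈ S := fun t ht s hs => (hN t ht s).1 hs
  have hconj' : ∀ t ∈ T, ∀ s ∈ S, t⁻¹ * s * t ∈ S := fun t ht s hs =>
    (hN t ht (t⁻¹ * s * t)).2 (by simpa only [mul_assoc, mul_inv_cancel_left, mul_inv_cancel, mul_one] using hs)
  refine ⟨Finset.ext fun x => ⟨fun hx => ?_, fun hx => ?_⟩, Finset.ext fun x => ⟨fun hx => ?_, fun hx => ?_⟩⟩
  · obtain ⟨s, hs, t, ht, rfl⟩ := Finset.mem_mul.1 hx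
    exact Finset.mem_mul.2 ⟨t, ht, t⁻¹ * s * t, hconj' t ht s hs, by group⟩
  · obtain ⟨t, ht, s, hs, rfl⟩ := Finset.mem_mul.1 hx
    exact Finset.mem_mul.2 ⟨t * s * t⁻¹, hconj t ht s hs, t, ht, by group⟩
  · obtain ⟨s, hs, t', ht', rfl⟩ := Finset.mem_mul.1 hx
    have ht : t'⁻¹ ∈ T := Finset.mem_inv'.1 ht'
    exact Finset.mem_mul.2 ⟨t', ht', t'⁻¹ * s * t'⁻¹⁻¹, hconj (t'⁻¹) ht s hs, by group⟩
  · obtain ⟨t', ht', s, hs, rfl⟩ := Finset.mem_mul.1 hx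
    have ht : t'⁻¹ ∈ T := Finset.mem_inv'.1 ht'
    exact Finset.mem_mul.2 ⟨(t'⁻¹)⁻¹ * s * t'⁻¹, hconj' (t'⁻¹) ht s hs, t', ht', by group⟩

/-- **Murthy 2026, Prop. 2.6 (2), the "or by each other" clause, subset form** ("`Y ⊄ N_G(X)` for any
distinct members `X, Y`"; contrapositive): if every element of the member `T` normalises the member
`S` as a set, then `|S| |T| |U| ≤ |G|` — by the note's own one-line reduction to (1).
[cite: Murthy2026, Prop. 2.6 (2)] -/
theorem Murthy2026_prop26_2_subset_normalizer [Fintype G] {S T U : Finset G}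
    (h : TripleProductProperty S T U) (hN : ∀ t ∈ T, ∀ x : G, x ∈ S ↔ t * x * t⁻¹ ∈ S) :
    S.card * T.card * U.card ≤ Fintype.card G := by
  obtain ⟨h1, h2⟩ := mul_comm_of_forall_mem_normalizer hN
  exact Murthy2026_prop26_1 h h1 h2

end Literature.Combinatorics.Additive
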